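import Summits.HodgeConjecture.HodgeConjecture.Theorems.K2E3UnitaryLayerInvolution          -- ★ p855828 (this seat): (Lay-U-1) `θ_J` calculus, `𝔲 ⊕ 𝔭`, plus∕minus invisibility, second-order unitarity
import Summits.HodgeConjecture.HodgeConjecture.Theorems.K2E3CongruenceLayerIntertwiningGL   -- ★ p855559 (this seat): heights & overlaps `mem_overlap_of_mem_congruenceGL_pow_add`; brings ★ p855532 (H-char) and ★ p855410 (H1)
import HarnessLib

/-!
# Crux `H413` — K2-LIT E3 «EllipticInputs», U12-h engine (Char-U): EXACT NON-DEGENERACY AND NEAR-COMMUTATION FOR THE LAYER CHARACTERS OF A UNITARY GROUP — if the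
# character `χ_X(k) = ψ(tr(X(k − 1)))` of a parameter `X` in the `θ_J`-eigenspace `𝔰_ε = {θ_J X = εX}` is trivial on the unitary bi-level set `U(σ,J) ∩ K_m ∩ xK_{m₂}x⁻¹`
# (`x ∈ U`), then `ψ(tr(XW)) = 1` for EVERY matrix `W` of bi-level `(m + O(1), m₂ + O(1))` — by a CAYLEY-TEST INDUCTION that doubles the level of the error at each step and
# the invisibility of `𝔭` (★ Lay-U-1); whence `v(X) ≤ |ϖ|^{−m−O(1)}` (★ GL non-degeneracy) and the brick `hint` (agreement on a `U`-overlap ⇒ `‖Ad(y)X − X′‖ ≤ q^{m+H}`) of the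
# depth-halving endgame ★ p855853 `exists_nhds_levelTraceStable_of_bricks_defect` at a NON-SPLIT place (`S := 𝔰_ε`)

Cell `hodgecm-mathlib`, Track B «K2-LIT», crux item `stmt-HodgeConjecture-24833` (h413), line `K2_E3_EllipticInputs`, unit U12 «HC characters», socket U12-h
`sig_K2E3CharLocConstNearRegular` (‹#9L›), depth-halving road, non-split transport (memo v4 §2 (Lay-U)∕(Char-U)∕(N-U); design K2 bus 2026-09-03T23:46:52Z; frame K2E3-p14 (g2)
23:49:05Z `U := unitaryGroupOfForm σ J ≤ GL (Fin N) E`; docking target K2E3-p09 (g2) 23:54:14Z = the `hint`∕`hS`∕`hocc` binders of ★ p855853); seat K2E1b-p08 (g2); `--supports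
stmt-HodgeConjecture-24833 --as helper`.  THEOREMS ONLY — no `def`, no named fact, no instance, no notation, no `sorry`.  GENERIC: `E` a field with a `ValuativeRel` and a uniformizer
`ϖ` (★ `IsUniformizingElement`), `σ : E →+* E` involutive and ISOMETRIC, `J` hermitian with unit determinant and entrywise bounds `v(J) ≤ κ`, `v(J⁻¹) ≤ κ′`, `Invertible (2 : E)`,
`ψ : AddChar E M` trivial on `𝒪` (and, where stated, non-trivial on `ϖ⁻¹𝒪`).  THE TWIST `ε` (uniformity over ALL non-split places): parameters live in `𝔰_ε := {θ_J X = ε•X}` and `ψ`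
kills the scalars with `σ a = ε a`; `ε = −1`: `𝔰 = 𝔲`, `ψ = ψ_F∘tr_{E∕F}(c·)` with `c ∈ F` (unramified places, and ramified places of even different exponent); `ε = +1`: `𝔰 = 𝔭`,
`c` with `σc = −c` (ramified places of odd different exponent) — in both cases `c` is chosen so that `ψ` has conductor EXACTLY `𝒪_E`, which is what ★ GL non-degeneracy wants; no
hypothesis `ε = ±1` is needed in this file.  ALL defects (`v(⅟2)`, `κ`, `κ′`) enter through ONE exponent `d` with `v(⅟2)²·max(1, κ′κ)·|ϖ|^d ≤ 1` (`d = 0` at an unramified place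
with `J` unimodular and `2 ∈ 𝒪^×`).  HONEST LABEL: HC_CM is proved only modulo the 7 printed citations (2 remaining named inputs: hLiu418 = stmt-HodgeConjecture-24832, h413 =
stmt-HodgeConjecture-24833) until rung 0 closes; count-neutral.

THE MATHEMATICS [HarishChandra1999, §17 p. 80, Thm. 17.1; Weyl1939, Ch. II §10; PlatonovRapinchuk1994, §2.3, §3.3].  `X ∈ 𝔰_ε` of height `L₀`, `x ∈ U`, `χ_X ≡ 1` on
`{k ∈ U ∩ K_m : x⁻¹kx ∈ K_{m₂}}`.  CLAIM `Q(a,b)`: `ψ(tr(XZ)) = 1` for every `Z ∈ 𝔲` of bi-level `(a,b)` (`v(Z) ≤ |ϖ|^a`, `v(x⁻¹Zx) ≤ |ϖ|^b`), `a ≥ max(m,d+1)`, `b ≥ max(m₂,d+1)`;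
for `a ≥ L₀` this is integrality.  STEP: `Y := −½Z ∈ 𝔲`, `k := c(Y) ∈ U` (★ `cayley_mem_unitaryGroupOfForm`), `k − 1 = Z(1+Y)⁻¹ = Z + R′` with `R′` of bi-level ≈ `(2a, 2b)`, so `k`
is in the bi-level set and `1 = χ_X(k) = ψ(tr(XZ))·ψ(tr(XR))` with `R := ½(R′ − θR′) ∈ 𝔲` of bi-level `(2a−d, 2b−d)` — the `𝔭`-part of `k − 1` is INVISIBLE for `X ∈ 𝔰_ε`
(`map_trace_mul_eq_one_of_eigen`); induction on `L₀ − a`.  COROLLARIES: `ψ(tr(XW)) = 1` for ALL `W` of bi-level `≥ (max(m,d+1)+d, max(m₂,d+1)+d)` (`map_trace_mul_eq_one_of_bilevel`,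
the (N-U) transfer to ★ GL (N)); `x = 1`: **`χ_X ≡ 1` on `U ∩ K_m` ⇒ `v(X) ≤ |ϖ|^{−m′}`, `m′ ≥ max(m,d+1)+d`** (`valBound_of_forall_unitary_layer`); **hint-U**: agreement of `χ_X(y⁻¹·y)`
and `χ_{X′}` on `{a ∈ U ∩ K_m : y⁻¹ay ∈ K_m}`, `y ∈ U` of height `h` ⇒ `v(yXy⁻¹ − X′) ≤ |ϖ|^{−m′}`, `m′ ≥ max(m+2h,d+1)+d` (`valBound_conj_sub_of_agree_on_unitary_overlap`; `H = 2h+2d+1`).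

## References
* [HarishChandra1999] Harish-Chandra (DeBacker–Sally), *Admissible Invariant Distributions on Reductive p-adic Groups*, ULECT 16 (1999), §17 p. 80, Thm. 17.1.
* [Weyl1939] H. Weyl, *The Classical Groups* (1939), Ch. II §10 (Cayley parametrisation).
* [PlatonovRapinchuk1994] V. Platonov, A. Rapinchuk, *Algebraic Groups and Number Theory* (1994), §2.3, §3.3.
-/

set_option autoImplicit false
-- the mandated namespace repeats `HodgeConjecture.HodgeConjecture`, as in every `Theorems/*.lean` of this sub-problem
set_option linter.dupNamespace false

noncomputable section

open scoped MatrixGroups Matrix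
open ValuativeRel Literature.NumberTheory.Automorphic Literature.LinearAlgebra.Matrix Literature.Analysis.Calculus

namespace Summit.HodgeConjecture.HodgeConjecture.Cruxes.H413.K2E3UnitaryLayerCharacters

variable {E : Type*} [Field E] [ValuativeRel E] {N : ℕ} (σ : E →+* E) {J : Matrix (Fin N) (Fin N) E} {ϖ : E}

/-! ## §1 Bookkeeping: valuations of `θ_J`, scalings, `𝔰_ε`-parts; the defect exponent; the Cayley test element -/

/-- `θ_J` is bounded: `v(Y) ≤ γ`, `v(J) ≤ κ`, `v(J⁻¹) ≤ κ′`, `σ` isometric ⇒ `v(θ_J Y) ≤ κ′γκ`. [cite: PlatonovRapinchuk1994, §2.3] -/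
theorem valBound_formAdjoint (hσv : ∀ a : E, valuation E (σ a) = valuation E a) {κ κ' γ : ValueGroupWithZero E} (hJb : ValBound κ J) (hJib : ValBound κ' J⁻¹)
    {Y : Matrix (Fin N) (Fin N) E} (hY : ValBound γ Y) : ValBound (κ' * γ * κ) (J⁻¹ * (Y.map σ)ᵀ * J) := by
  have h1 : ValBound γ (Y.map σ)ᵀ := fun i j => by rw [Matrix.transpose_apply, Matrix.map_apply, hσv]; exact hY j i
  exact (hJib.mul h1).mul hJb

omit σ in
/-- `v(a • Y) ≤ v(a)·γ` for `v(Y) ≤ γ`. [folklore] -/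
theorem valBound_smul {γ : ValueGroupWithZero E} (a : E) {Y : Matrix (Fin N) (Fin N) E} (hY : ValBound γ Y) : ValBound (valuation E a * γ) (a • Y) := fun i j => by
  rw [Matrix.smul_apply, smul_eq_mul, map_mul]; exact mul_le_mul' le_rfl (hY i j)

/-- The `𝔲`-part `⅟2(W − θW)` of `W` with `v(W) ≤ γ` has `v ≤ v(⅟2)·max(1, κ′κ)·γ`. [cite: PlatonovRapinchuk1994, §2.3] -/
theorem valBound_half_sub_formAdjoint [Invertible (2 : E)] (hσv : ∀ a : E, valuation E (σ a) = valuation E a) {κ κ' γ : ValueGroupWithZero E} (hJb : ValBound κ J)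
    (hJib : ValBound κ' J⁻¹) {W : Matrix (Fin N) (Fin N) E} (hW : ValBound γ W) :
    ValBound (valuation E (⅟(2 : E)) * max 1 (κ' * κ) * γ) (⅟(2 : E) • (W - J⁻¹ * (W.map σ)ᵀ * J)) := by
  have h1 : ValBound (max 1 (κ' * κ) * γ) W := hW.mono (le_mul_of_one_le_left' (le_max_left _ _))
  have h2 : ValBound (max 1 (κ' * κ) * γ) (J⁻¹ * (W.map σ)ᵀ * J) :=
    (valBound_formAdjoint σ hσv hJb hJib hW).mono (by rw [mul_assoc, mul_comm γ, ← mul_assoc]; exact mul_le_mul' (le_max_right _ _) le_rfl)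
  rw [mul_assoc]; exact valBound_smul _ (h1.sub h2)

/-- … and the `𝔭`-part `⅟2(W + θW)` likewise. [cite: PlatonovRapinchuk1994, §2.3] -/
theorem valBound_half_add_formAdjoint [Invertible (2 : E)] (hσv : ∀ a : E, valuation E (σ a) = valuation E a) {κ κ' γ : ValueGroupWithZero E} (hJb : ValBound κ J)
    (hJib : ValBound κ' J⁻¹) {W : Matrix (Fin N) (Fin N) E} (hW : ValBound γ W) :
    ValBound (valuation E (⅟(2 : E)) * max 1 (κ' * κ) * γ) (⅟(2 : E) • (W + J⁻¹ * (W.map σ)ᵀ * J)) := by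
  have h1 : ValBound (max 1 (κ' * κ) * γ) W := hW.mono (le_mul_of_one_le_left' (le_max_left _ _))
  have h2 : ValBound (max 1 (κ' * κ) * γ) (J⁻¹ * (W.map σ)ᵀ * J) :=
    (valBound_formAdjoint σ hσv hJb hJib hW).mono (by rw [mul_assoc, mul_comm γ, ← mul_assoc]; exact mul_le_mul' (le_max_right _ _) le_rfl)
  rw [mul_assoc]; exact valBound_smul _ (h1.add h2)

omit σ in
/-- `1 ≤ v(⅟2)` (as `2 ∈ 𝒪`). [folklore] -/
theorem one_le_valuation_invOf_two [Invertible (2 : E)] : 1 ≤ valuation E (⅟(2 : E)) := by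
  have h2 : valuation E (2 : E) ≤ 1 := by
    rw [← one_add_one_eq_two]; exact (Valuation.map_add _ _ _).trans (max_le (by rw [map_one]) (by rw [map_one]))
  rw [invOf_eq_inv, map_inv₀]
  exact (one_le_inv₀ ((Valuation.pos_iff _).2 (Invertible.ne_zero (2 : E)))).2 h2

omit σ in
/-- **THE DEFECT EXPONENT `d`** (`c·(c·μ)·|ϖ|^d ≤ 1` with `1 ≤ c`, `1 ≤ μ`; here `c = v(⅟2)`, `μ = max(1, κ′κ)`): for `a ≥ d + 1`, (i) `c|ϖ|^a < 1`; (ii) `cμ·(|ϖ|^a·c|ϖ|^a) ≤ |ϖ|^{2a−d}`;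
(iii) `cμ|ϖ|^a ≤ |ϖ|^{a−d}`. [folklore] -/
theorem defect_arith (hϖ : IsUniformizingElement ϖ) {c μ : ValueGroupWithZero E} (hc : 1 ≤ c) (hμ : 1 ≤ μ) {d : ℕ} (hd : c * (c * μ) * valuation E ϖ ^ d ≤ 1) {a : ℕ}
    (ha : d + 1 ≤ a) :
    c * valuation E ϖ ^ a < 1 ∧ c * μ * (valuation E ϖ ^ a * (c * valuation E ϖ ^ a)) ≤ valuation E ϖ ^ (2 * a - d) ∧ c * μ * valuation E ϖ ^ a ≤ valuation E ϖ ^ (a - d) := by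
  have hπ1 := hϖ.valuation_le_one
  have hcD : c ≤ c * (c * μ) := le_mul_of_one_le_right' (one_le_mul hc hμ)
  have hcμD : c * μ ≤ c * (c * μ) := mul_le_mul' le_rfl (le_mul_of_one_le_left' hc)
  refine ⟨?_, ?_, ?_⟩
  · calc c * valuation E ϖ ^ a ≤ c * (c * μ) * valuation E ϖ ^ (d + 1) := mul_le_mul' hcD (pow_le_pow_right_of_le_one' hπ1 ha)
      _ = c * (c * μ) * valuation E ϖ ^ d * valuation E ϖ := by rw [pow_succ, ← mul_assoc]
      _ ≤ 1 * valuation E ϖ := mul_le_mul' hd le_rfl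
      _ < 1 := by rw [one_mul]; exact hϖ.valuation_lt_one
  · calc c * μ * (valuation E ϖ ^ a * (c * valuation E ϖ ^ a)) = c * (c * μ) * valuation E ϖ ^ d * valuation E ϖ ^ (2 * a - d) := by
          rw [mul_assoc (c * (c * μ)), ← pow_add, show d + (2 * a - d) = a + a by omega, pow_add]; simp only [mul_assoc, mul_left_comm]
      _ ≤ 1 * valuation E ϖ ^ (2 * a - d) := mul_le_mul' hd le_rfl
      _ = _ := one_mul _
  · calc c * μ * valuation E ϖ ^ a ≤ c * (c * μ) * valuation E ϖ ^ a := mul_le_mul' hcμD le_rfl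
      _ = c * (c * μ) * valuation E ϖ ^ d * valuation E ϖ ^ (a - d) := by rw [mul_assoc (c * (c * μ)), ← pow_add, show d + (a - d) = a by omega]
      _ ≤ 1 * valuation E ϖ ^ (a - d) := mul_le_mul' hd le_rfl
      _ = _ := one_mul _

omit σ in
/-- **THE CAYLEY TEST ELEMENT**: for `v(Y) ≤ η < 1`, `1 + Y` is invertible, `(1+Y)⁻¹` is integral with `v((1+Y)⁻¹ − 1) ≤ η` (★ `isUnit_det_and_valBound_inv`), and
`c(Y) − 1 = −(Y + Y)(1 + Y)⁻¹` (★ `one_sub_cayley`). [cite: Weyl1939, Ch. II §10] -/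
theorem cayley_sub_one_eq {η : ValueGroupWithZero E} (hη : η < 1) {Y : Matrix (Fin N) (Fin N) E} (hY : ValBound η Y) :
    IsUnit (1 + Y) ∧ ValBound 1 (1 + Y)⁻¹ ∧ ValBound η ((1 + Y)⁻¹ - 1) ∧ cayley Y - 1 = -((Y + Y) * (1 + Y)⁻¹) := by
  have hY' : ValBound η ((1 + Y) - 1) := by rwa [add_sub_cancel_left]
  obtain ⟨hdet, h1, h2⟩ := isUnit_det_and_valBound_inv hY' hη
  have hu : IsUnit (1 + Y) := (Matrix.isUnit_iff_isUnit_det _).2 hdet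
  refine ⟨hu, h1, h2, ?_⟩
  have h := one_sub_cayley hu
  rw [← Matrix.nonsing_inv_eq_ringInverse, two_mul] at h
  rw [← neg_sub, h]

omit σ in
/-- Membership in `K_δ` from an entrywise bound `v(g − 1) ≤ γ < 1`, `γ ≤ δ` (the inverse is handled by ★ `isUnit_det_and_valBound_inv`). [folklore] -/
theorem mem_congruenceGL_of_valBound_coe_sub_one {γ δ : ValueGroupWithZero E} (hγ : γ < 1) (hγδ : γ ≤ δ) {g : GL (Fin N) E}
    (hval : ValBound γ ((g : Matrix (Fin N) (Fin N) E) - 1)) : g ∈ congruenceGL N δ := by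
  obtain ⟨-, hi1, hi2⟩ := isUnit_det_and_valBound_inv hval hγ
  refine ⟨⟨hval.of_sub_one hγ.le, ?_⟩, hval.mono hγδ, ?_⟩ <;> rw [Matrix.coe_units_inv]
  exacts [hi1, hi2.mono hγδ]

omit [ValuativeRel E] in
/-- Conjugating a matrix inverse by `x ∈ GL`: `x⁻¹ A⁻¹ x = (x⁻¹ A x)⁻¹`. [folklore] -/
theorem coe_inv_mul_inv_mul_coe (x : GL (Fin N) E) (A : Matrix (Fin N) (Fin N) E) :
    ((x⁻¹ : GL (Fin N) E) : Matrix (Fin N) (Fin N) E) * A⁻¹ * (x : Matrix (Fin N) (Fin N) E) =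
      (((x⁻¹ : GL (Fin N) E) : Matrix (Fin N) (Fin N) E) * A * (x : Matrix (Fin N) (Fin N) E))⁻¹ := by
  rw [Matrix.mul_inv_rev, Matrix.mul_inv_rev, ← Matrix.coe_units_inv, ← Matrix.coe_units_inv, inv_inv, Matrix.mul_assoc]

omit [ValuativeRel E] in
/-- `θ_J (x⁻¹ R x) = x⁻¹ · θ_J R · x` for `x ∈ U(σ, J)` (★ `formAdjoint_conj_of_mem` for `x⁻¹`). [cite: PlatonovRapinchuk1994, §2.3] -/
theorem formAdjoint_inv_conj_of_mem (hJu : IsUnit J.det) {x : GL (Fin N) E} (hx : x ∈ unitaryGroupOfForm σ J) (R : Matrix (Fin N) (Fin N) E) :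
    J⁻¹ * ((((x⁻¹ : GL (Fin N) E) : Matrix (Fin N) (Fin N) E) * R * (x : Matrix (Fin N) (Fin N) E)).map σ)ᵀ * J =
      ((x⁻¹ : GL (Fin N) E) : Matrix (Fin N) (Fin N) E) * (J⁻¹ * (R.map σ)ᵀ * J) * (x : Matrix (Fin N) (Fin N) E) := by
  have h := K2E3UnitaryLayerInvolution.formAdjoint_conj_of_mem σ hJu (Subgroup.inv_mem _ hx) R
  rwa [inv_inv] at h

omit [ValuativeRel E] in
/-- `Ad(g)`, `g ∈ U(σ, J)`, preserves every `θ_J`-eigenspace: `θY = ε•Y ⇒ θ(gYg⁻¹) = ε•(gYg⁻¹)`. [cite: PlatonovRapinchuk1994, §2.3] -/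
theorem formAdjoint_conj_eq_smul_of_mem (hJu : IsUnit J.det) {g : GL (Fin N) E} (hg : g ∈ unitaryGroupOfForm σ J) {ε : E} {Y : Matrix (Fin N) (Fin N) E}
    (hY : J⁻¹ * (Y.map σ)ᵀ * J = ε • Y) :
    J⁻¹ * (((g : Matrix (Fin N) (Fin N) E) * Y * ((g⁻¹ : GL (Fin N) E) : Matrix (Fin N) (Fin N) E)).map σ)ᵀ * J =
      ε • ((g : Matrix (Fin N) (Fin N) E) * Y * ((g⁻¹ : GL (Fin N) E) : Matrix (Fin N) (Fin N) E)) := by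
  rw [K2E3UnitaryLayerInvolution.formAdjoint_conj_of_mem σ hJu hg, hY, Matrix.mul_smul, Matrix.smul_mul]

section Character

variable {M : Type*} [CommMonoid M] (ψ : AddChar E M)

omit [ValuativeRel E] in
/-- **TWISTED INVISIBILITY**: if `ψ` kills the scalars with `σ a = ε a`, then `ψ(tr(XP)) = 1` for `θX = ε•X` and `θP = P` (★ master trace identity `σ(tr(XP)) = tr(θX·θP) = ε·tr(XP)`).
For `ε = −1` this is ★ `map_trace_mul_eq_one_of_plus_minus`. [cite: HarishChandra1999, §17 p. 80] [cite: PlatonovRapinchuk1994, §2.3] -/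
theorem map_trace_mul_eq_one_of_eigen {ε : E} (hanti : ∀ a : E, σ a = ε * a → ψ a = 1) (hJu : IsUnit J.det) {X P : Matrix (Fin N) (Fin N) E}
    (hX : J⁻¹ * (X.map σ)ᵀ * J = ε • X) (hP : J⁻¹ * (P.map σ)ᵀ * J = P) : ψ (Matrix.trace (X * P)) = 1 :=
  hanti _ (by rw [K2E3UnitaryLayerInvolution.map_trace_mul σ hJu, hX, hP, Matrix.smul_mul, Matrix.trace_smul, smul_eq_mul])

end Character

/-! ## §2 The Cayley-test induction -/

section Induction

variable [Invertible (2 : E)] {M : Type*} [CommMonoid M] (ψ : AddChar E M)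

/-- **THE STEP.**  `X ∈ 𝔰_ε` with `χ_X ≡ 1` on `{k ∈ U ∩ K_m : x⁻¹kx ∈ K_{m₂}}` (`x ∈ U`); `Z ∈ 𝔲` of bi-level `(a, b) ≥ (max(m,d+1), max(m₂,d+1))`.  Then there is `R ∈ 𝔲` of bi-level
`(2a − d, 2b − d)` with `ψ(tr(XZ))·ψ(tr(XR)) = 1` — test `χ_X` on the Cayley element `c(−½Z) ∈ U`, `c(−½Z) − 1 = Z(1 − ½Z)⁻¹ = Z + R′`, discard the `𝔭`-part (twisted invisibility),
`R := ½(R′ − θR′)`. [cite: HarishChandra1999, §17 Thm. 17.1] [cite: Weyl1939, Ch. II §10] [cite: PlatonovRapinchuk1994, §3.3] -/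
theorem exists_remainder_of_cayley_test (hϖ : IsUniformizingElement ϖ) {ε : E} (hanti : ∀ a : E, σ a = ε * a → ψ a = 1)
    (hσ : ∀ a : E, σ (σ a) = a) (hσv : ∀ a : E, valuation E (σ a) = valuation E a) (hJ : (J.map σ)ᵀ = J) (hJu : IsUnit J.det)
    {κ κ' : ValueGroupWithZero E} (hJb : ValBound κ J) (hJib : ValBound κ' J⁻¹) {d : ℕ}
    (hd : valuation E (⅟(2 : E)) * (valuation E (⅟(2 : E)) * max 1 (κ' * κ)) * valuation E ϖ ^ d ≤ 1)
    {X : Matrix (Fin N) (Fin N) E} (hXu : J⁻¹ * (X.map σ)ᵀ * J = ε • X) {x : GL (Fin N) E} (hx : x ∈ unitaryGroupOfForm σ J) {m m₂ : ℕ}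
    (htriv : ∀ k ∈ unitaryGroupOfForm σ J, k ∈ congruenceGL N (valuation E ϖ ^ m) → x⁻¹ * k * x ∈ congruenceGL N (valuation E ϖ ^ m₂) →
      ψ (Matrix.trace (X * ((k : Matrix (Fin N) (Fin N) E) - 1))) = 1)
    {a b : ℕ} (ha : max m (d + 1) ≤ a) (hb : max m₂ (d + 1) ≤ b) {Z : Matrix (Fin N) (Fin N) E} (hZu : J⁻¹ * (Z.map σ)ᵀ * J = -Z)
    (hZa : ValBound (valuation E ϖ ^ a) Z) (hZb : ValBound (valuation E ϖ ^ b) (((x⁻¹ : GL (Fin N) E) : Matrix (Fin N) (Fin N) E) * Z * (x : Matrix (Fin N) (Fin N) E))) :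
    ∃ R : Matrix (Fin N) (Fin N) E, J⁻¹ * (R.map σ)ᵀ * J = -R ∧ ValBound (valuation E ϖ ^ (2 * a - d)) R ∧
      ValBound (valuation E ϖ ^ (2 * b - d)) (((x⁻¹ : GL (Fin N) E) : Matrix (Fin N) (Fin N) E) * R * (x : Matrix (Fin N) (Fin N) E)) ∧
      ψ (Matrix.trace (X * Z)) * ψ (Matrix.trace (X * R)) = 1 := by
  obtain ⟨hma, hda⟩ := max_le_iff.1 ha
  obtain ⟨hmb, hdb⟩ := max_le_iff.1 hb
  have hc1 : (1 : ValueGroupWithZero E) ≤ valuation E (⅟(2 : E)) := one_le_valuation_invOf_two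
  have hμ1 : (1 : ValueGroupWithZero E) ≤ max 1 (κ' * κ) := le_max_left _ _
  obtain ⟨hηa, h2a, -⟩ := defect_arith hϖ hc1 hμ1 hd hda
  obtain ⟨hηb, h2b, -⟩ := defect_arith hϖ hc1 hμ1 hd hdb
  have hπa : valuation E ϖ ^ a < 1 := pow_lt_one₀ zero_le hϖ.valuation_lt_one (by omega)
  have hπb : valuation E ϖ ^ b < 1 := pow_lt_one₀ zero_le hϖ.valuation_lt_one (by omega)
  -- the test element `Y := −½Z ∈ 𝔲` and its conjugate `Y′ := x⁻¹Yx = −½(x⁻¹Zx)`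
  set Y : Matrix (Fin N) (Fin N) E := (-⅟(2 : E)) • Z with hY_def
  have hYu : J⁻¹ * (Y.map σ)ᵀ * J = -Y := by
    rw [hY_def, K2E3UnitaryLayerInvolution.formAdjoint_smul σ, map_neg, K2E3UnitaryLayerInvolution.map_invOf_two σ, hZu, smul_neg]
  have hYb : ValBound (valuation E (⅟(2 : E)) * valuation E ϖ ^ a) Y := by
    have h := valBound_smul (-⅟(2 : E)) hZa; rwa [Valuation.map_neg] at h
  have hY'b : ValBound (valuation E (⅟(2 : E)) * valuation E ϖ ^ b)
      ((-⅟(2 : E)) • (((x⁻¹ : GL (Fin N) E) : Matrix (Fin N) (Fin N) E) * Z * (x : Matrix (Fin N) (Fin N) E))) := by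
    have h := valBound_smul (-⅟(2 : E)) hZb; rwa [Valuation.map_neg] at h
  have hY' : ((x⁻¹ : GL (Fin N) E) : Matrix (Fin N) (Fin N) E) * Y * (x : Matrix (Fin N) (Fin N) E) =
      (-⅟(2 : E)) • (((x⁻¹ : GL (Fin N) E) : Matrix (Fin N) (Fin N) E) * Z * (x : Matrix (Fin N) (Fin N) E)) := by
    rw [hY_def, Matrix.mul_smul, Matrix.smul_mul]
  obtain ⟨hu, hinv1, hinv2, hcay⟩ := cayley_sub_one_eq hηa hYb
  obtain ⟨-, hinv1', hinv2', -⟩ := cayley_sub_one_eq hηb hY'b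
  have hu' : IsUnit (1 - Y) := by rw [sub_eq_add_neg]; exact (cayley_sub_one_eq hηa hYb.neg).1
  have hYY : Y + Y = -Z := by rw [hY_def, ← add_smul, ← neg_add, invOf_two_add_invOf_two, neg_one_smul]
  -- `c(Y) − 1 = Z(1+Y)⁻¹ = Z + R′`
  have hW0 : cayley Y - 1 = Z * (1 + Y)⁻¹ := by rw [hcay, hYY, neg_mul, neg_neg]
  set R' : Matrix (Fin N) (Fin N) E := Z * ((1 + Y)⁻¹ - 1) with hR'_def
  have hW : cayley Y - 1 = Z + R' := by rw [hW0, hR'_def, Matrix.mul_sub, Matrix.mul_one, add_sub_cancel]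
  have hR'b : ValBound (valuation E ϖ ^ a * (valuation E (⅟(2 : E)) * valuation E ϖ ^ a)) R' := hZa.mul hinv2
  -- conjugates by `x`
  have hconj1 : ((x⁻¹ : GL (Fin N) E) : Matrix (Fin N) (Fin N) E) * (1 + Y) * (x : Matrix (Fin N) (Fin N) E) =
      1 + (-⅟(2 : E)) • (((x⁻¹ : GL (Fin N) E) : Matrix (Fin N) (Fin N) E) * Z * (x : Matrix (Fin N) (Fin N) E)) := by
    rw [Matrix.mul_add, Matrix.add_mul, Matrix.mul_one, Units.inv_mul, hY']
  have hconjinv : ((x⁻¹ : GL (Fin N) E) : Matrix (Fin N) (Fin N) E) * (1 + Y)⁻¹ * (x : Matrix (Fin N) (Fin N) E) =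
      (1 + (-⅟(2 : E)) • (((x⁻¹ : GL (Fin N) E) : Matrix (Fin N) (Fin N) E) * Z * (x : Matrix (Fin N) (Fin N) E)))⁻¹ := by
    rw [coe_inv_mul_inv_mul_coe, hconj1]
  have hxR' : ((x⁻¹ : GL (Fin N) E) : Matrix (Fin N) (Fin N) E) * R' * (x : Matrix (Fin N) (Fin N) E) =
      (((x⁻¹ : GL (Fin N) E) : Matrix (Fin N) (Fin N) E) * Z * (x : Matrix (Fin N) (Fin N) E)) *
        ((1 + (-⅟(2 : E)) • (((x⁻¹ : GL (Fin N) E) : Matrix (Fin N) (Fin N) E) * Z * (x : Matrix (Fin N) (Fin N) E)))⁻¹ - 1) := by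
    rw [← hconjinv, Matrix.mul_sub, Matrix.mul_one, hR'_def, Matrix.mul_sub, Matrix.mul_one, Matrix.mul_sub, Matrix.sub_mul]
    congr 1
    simp only [Matrix.mul_assoc]
    rw [Units.mul_inv_cancel_left]
  have hxR'b : ValBound (valuation E ϖ ^ b * (valuation E (⅟(2 : E)) * valuation E ϖ ^ b))
      (((x⁻¹ : GL (Fin N) E) : Matrix (Fin N) (Fin N) E) * R' * (x : Matrix (Fin N) (Fin N) E)) := by
    rw [hxR']; exact hZb.mul hinv2'
  -- the test element `g = c(Y) ∈ U ∩ K_m` with `x⁻¹gx ∈ K_{m₂}`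
  obtain ⟨g, hgU, hg⟩ := cayley_mem_unitaryGroupOfForm σ hJu hYu hu hu'
  have hgK : g ∈ congruenceGL N (valuation E ϖ ^ m) := by
    refine mem_congruenceGL_of_valBound_coe_sub_one hπa (pow_le_pow_right_of_le_one' hϖ.valuation_le_one hma) ?_
    rw [hg, hW0]; simpa only [mul_one] using hZa.mul hinv1
  have hgxK : x⁻¹ * g * x ∈ congruenceGL N (valuation E ϖ ^ m₂) := by
    refine mem_congruenceGL_of_valBound_coe_sub_one hπb (pow_le_pow_right_of_le_one' hϖ.valuation_le_one hmb) ?_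
    have h := K2E3CongruenceLayersGL.coe_conj_sub_one x⁻¹ g
    rw [inv_inv] at h
    rw [h, hg, hW0, show ((x⁻¹ : GL (Fin N) E) : Matrix (Fin N) (Fin N) E) * (Z * (1 + Y)⁻¹) * (x : Matrix (Fin N) (Fin N) E) =
        (((x⁻¹ : GL (Fin N) E) : Matrix (Fin N) (Fin N) E) * Z * (x : Matrix (Fin N) (Fin N) E)) *
          (((x⁻¹ : GL (Fin N) E) : Matrix (Fin N) (Fin N) E) * (1 + Y)⁻¹ * (x : Matrix (Fin N) (Fin N) E)) by
      simp only [Matrix.mul_assoc]; rw [Units.mul_inv_cancel_left], hconjinv]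
    simpa only [mul_one] using hZb.mul hinv1'
  have hψW : ψ (Matrix.trace (X * (cayley Y - 1))) = 1 := by have h := htriv g hgU hgK hgxK; rwa [hg] at h
  -- split `W = W⁻ + W⁺`; `W⁻ = Z + R`, `R := ½(R′ − θR′)`; `W⁺` is invisible
  set R : Matrix (Fin N) (Fin N) E := ⅟(2 : E) • (R' - J⁻¹ * (R'.map σ)ᵀ * J) with hR_def
  have hRu : J⁻¹ * (R.map σ)ᵀ * J = -R := K2E3UnitaryLayerInvolution.formAdjoint_half_sub σ hσ hJ hJu R'
  have hθW : J⁻¹ * ((Z + R').map σ)ᵀ * J = -Z + J⁻¹ * (R'.map σ)ᵀ * J := by rw [formAdjoint_add σ, hZu]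
  have hsplit := K2E3UnitaryLayerInvolution.eq_half_sub_add_half_add (Z + R') (J⁻¹ * ((Z + R').map σ)ᵀ * J)
  have hWp := K2E3UnitaryLayerInvolution.formAdjoint_half_add σ hσ hJ hJu (Z + R')
  have hWm_eq : ⅟(2 : E) • ((Z + R') - J⁻¹ * ((Z + R').map σ)ᵀ * J) = Z + R := by
    rw [hθW, show Z + R' - (-Z + J⁻¹ * (R'.map σ)ᵀ * J) = (2 : E) • Z + (R' - J⁻¹ * (R'.map σ)ᵀ * J) by rw [two_smul]; abel,
      smul_add, smul_smul, invOf_mul_self, one_smul]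
  have hfac : ψ (Matrix.trace (X * (cayley Y - 1))) = ψ (Matrix.trace (X * Z)) * ψ (Matrix.trace (X * R)) := by
    rw [hW]
    conv_lhs => rw [hsplit]
    rw [Matrix.mul_add, Matrix.trace_add, AddChar.map_add_eq_mul, map_trace_mul_eq_one_of_eigen σ ψ hanti hJu hXu hWp, mul_one, hWm_eq,
      Matrix.mul_add, Matrix.trace_add, AddChar.map_add_eq_mul]
  -- bounds on `R` and `x⁻¹Rx`
  have hRb : ValBound (valuation E ϖ ^ (2 * a - d)) R := (valBound_half_sub_formAdjoint σ hσv hJb hJib hR'b).mono h2a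
  have hxR : ((x⁻¹ : GL (Fin N) E) : Matrix (Fin N) (Fin N) E) * R * (x : Matrix (Fin N) (Fin N) E) =
      ⅟(2 : E) • ((((x⁻¹ : GL (Fin N) E) : Matrix (Fin N) (Fin N) E) * R' * (x : Matrix (Fin N) (Fin N) E)) -
        J⁻¹ * (((((x⁻¹ : GL (Fin N) E) : Matrix (Fin N) (Fin N) E) * R' * (x : Matrix (Fin N) (Fin N) E))).map σ)ᵀ * J) := by
    rw [hR_def, Matrix.mul_smul, Matrix.smul_mul, Matrix.mul_sub, Matrix.sub_mul, formAdjoint_inv_conj_of_mem σ hJu hx]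
  have hxRb : ValBound (valuation E ϖ ^ (2 * b - d)) (((x⁻¹ : GL (Fin N) E) : Matrix (Fin N) (Fin N) E) * R * (x : Matrix (Fin N) (Fin N) E)) := by
    rw [hxR]; exact (valBound_half_sub_formAdjoint σ hσv hJb hJib hxR'b).mono h2b
  exact ⟨R, hRu, hRb, hxRb, hfac ▸ hψW⟩

/-- **THE INDUCTION `Q(a,b)`**: under the hypotheses of the step, for `X` of height `L₀` (`v(X) ≤ |ϖ|^{−L₀}`) and `ψ` trivial on `𝒪`: for all `n, a, b` with `a ≥ max(m, d+1)`,
`b ≥ max(m₂, d+1)`, `L₀ ≤ a + n`, and every `Z ∈ 𝔲` of bi-level `(a, b)`: **`ψ(tr(XZ)) = 1`** (induction on `n`; base `a ≥ L₀` = integrality).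
[cite: HarishChandra1999, §17 Thm. 17.1] [cite: Weyl1939, Ch. II §10] -/
theorem map_trace_mul_eq_one_of_minus_bilevel (hϖ : IsUniformizingElement ϖ) (hψ : ∀ x : E, valuation E x ≤ 1 → ψ x = 1) {ε : E}
    (hanti : ∀ a : E, σ a = ε * a → ψ a = 1) (hσ : ∀ a : E, σ (σ a) = a) (hσv : ∀ a : E, valuation E (σ a) = valuation E a) (hJ : (J.map σ)ᵀ = J)
    (hJu : IsUnit J.det) {κ κ' : ValueGroupWithZero E} (hJb : ValBound κ J) (hJib : ValBound κ' J⁻¹) {d : ℕ}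
    (hd : valuation E (⅟(2 : E)) * (valuation E (⅟(2 : E)) * max 1 (κ' * κ)) * valuation E ϖ ^ d ≤ 1)
    {X : Matrix (Fin N) (Fin N) E} (hXu : J⁻¹ * (X.map σ)ᵀ * J = ε • X) {L₀ : ℕ} (hXb : ValBound (valuation E ϖ ^ L₀)⁻¹ X)
    {x : GL (Fin N) E} (hx : x ∈ unitaryGroupOfForm σ J) {m m₂ : ℕ}
    (htriv : ∀ k ∈ unitaryGroupOfForm σ J, k ∈ congruenceGL N (valuation E ϖ ^ m) → x⁻¹ * k * x ∈ congruenceGL N (valuation E ϖ ^ m₂) →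
      ψ (Matrix.trace (X * ((k : Matrix (Fin N) (Fin N) E) - 1))) = 1) :
    ∀ n a b : ℕ, max m (d + 1) ≤ a → max m₂ (d + 1) ≤ b → L₀ ≤ a + n → ∀ Z : Matrix (Fin N) (Fin N) E, J⁻¹ * (Z.map σ)ᵀ * J = -Z →
      ValBound (valuation E ϖ ^ a) Z → ValBound (valuation E ϖ ^ b) (((x⁻¹ : GL (Fin N) E) : Matrix (Fin N) (Fin N) E) * Z * (x : Matrix (Fin N) (Fin N) E)) →
      ψ (Matrix.trace (X * Z)) = 1 := by
  intro n
  induction n with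
  | zero =>
    intro a b _ _ hL Z _ hZa _
    refine hψ _ ((K2E3CongruenceLayerCharactersGL.valuation_trace_mul_le hXb hZa).trans ?_)
    have hne : valuation E ϖ ^ L₀ ≠ 0 := pow_ne_zero _ ((Valuation.ne_zero_iff _).2 hϖ.ne_zero)
    calc (valuation E ϖ ^ L₀)⁻¹ * valuation E ϖ ^ a ≤ (valuation E ϖ ^ L₀)⁻¹ * valuation E ϖ ^ L₀ :=
          mul_le_mul' le_rfl (pow_le_pow_right_of_le_one' hϖ.valuation_le_one (by omega))
      _ = 1 := inv_mul_cancel₀ hne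
  | succ n ih =>
    intro a b ha hb hL Z hZu hZa hZb
    obtain ⟨R, hRu, hRa, hRb, hψ1⟩ := exists_remainder_of_cayley_test σ ψ hϖ hanti hσ hσv hJ hJu hJb hJib hd hXu hx htriv ha hb hZu hZa hZb
    obtain ⟨hma, hda⟩ := max_le_iff.1 ha; obtain ⟨hmb, hdb⟩ := max_le_iff.1 hb
    have h1 := ih (2 * a - d) (2 * b - d) (max_le_iff.2 ⟨by omega, by omega⟩) (max_le_iff.2 ⟨by omega, by omega⟩) (by omega) R hRu hRa hRb
    rwa [h1, mul_one] at hψ1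

/-- **TRIVIALITY ON A WHOLE GL BI-LEVEL**: under the same hypotheses, `ψ(tr(XW)) = 1` for EVERY `W` (not only `W ∈ 𝔲`) of bi-level `(a, b)` with `a ≥ max(m, d+1) + d`,
`b ≥ max(m₂, d+1) + d` — split `W = W⁻ + W⁺`, `W⁺` invisible, `W⁻ ∈ 𝔲` of bi-level `(a−d, b−d)`.  With the bi-level set `{k ∈ K_a : x⁻¹kx ∈ K_b}` this is the occurrence hypothesis of
★ GL (N) `exists_nilpotent_add_valBound_of_occurrence` — the (N-U) transfer. [cite: HarishChandra1999, §17 Thm. 17.1, §20 p. 84] [cite: Weyl1939, Ch. II §10] -/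
theorem map_trace_mul_eq_one_of_bilevel (hϖ : IsUniformizingElement ϖ) (hψ : ∀ x : E, valuation E x ≤ 1 → ψ x = 1) {ε : E}
    (hanti : ∀ a : E, σ a = ε * a → ψ a = 1) (hσ : ∀ a : E, σ (σ a) = a) (hσv : ∀ a : E, valuation E (σ a) = valuation E a) (hJ : (J.map σ)ᵀ = J)
    (hJu : IsUnit J.det) {κ κ' : ValueGroupWithZero E} (hJb : ValBound κ J) (hJib : ValBound κ' J⁻¹) {d : ℕ}
    (hd : valuation E (⅟(2 : E)) * (valuation E (⅟(2 : E)) * max 1 (κ' * κ)) * valuation E ϖ ^ d ≤ 1)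
    {X : Matrix (Fin N) (Fin N) E} (hXu : J⁻¹ * (X.map σ)ᵀ * J = ε • X) {L₀ : ℕ} (hXb : ValBound (valuation E ϖ ^ L₀)⁻¹ X)
    {x : GL (Fin N) E} (hx : x ∈ unitaryGroupOfForm σ J) {m m₂ : ℕ}
    (htriv : ∀ k ∈ unitaryGroupOfForm σ J, k ∈ congruenceGL N (valuation E ϖ ^ m) → x⁻¹ * k * x ∈ congruenceGL N (valuation E ϖ ^ m₂) →
      ψ (Matrix.trace (X * ((k : Matrix (Fin N) (Fin N) E) - 1))) = 1)
    {a b : ℕ} (ha : max m (d + 1) + d ≤ a) (hb : max m₂ (d + 1) + d ≤ b) {W : Matrix (Fin N) (Fin N) E} (hWa : ValBound (valuation E ϖ ^ a) W)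
    (hWb : ValBound (valuation E ϖ ^ b) (((x⁻¹ : GL (Fin N) E) : Matrix (Fin N) (Fin N) E) * W * (x : Matrix (Fin N) (Fin N) E))) :
    ψ (Matrix.trace (X * W)) = 1 := by
  have hma := le_max_left m (d + 1); have hda := le_max_right m (d + 1); have hmb := le_max_left m₂ (d + 1); have hdb := le_max_right m₂ (d + 1)
  have hc1 : (1 : ValueGroupWithZero E) ≤ valuation E (⅟(2 : E)) := one_le_valuation_invOf_two
  have hμ1 : (1 : ValueGroupWithZero E) ≤ max 1 (κ' * κ) := le_max_left _ _
  obtain ⟨-, -, h3a⟩ := defect_arith hϖ hc1 hμ1 hd (show d + 1 ≤ a by omega)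
  obtain ⟨-, -, h3b⟩ := defect_arith hϖ hc1 hμ1 hd (show d + 1 ≤ b by omega)
  have hsplit := K2E3UnitaryLayerInvolution.eq_half_sub_add_half_add W (J⁻¹ * (W.map σ)ᵀ * J)
  have hWp := K2E3UnitaryLayerInvolution.formAdjoint_half_add σ hσ hJ hJu W
  have hWm := K2E3UnitaryLayerInvolution.formAdjoint_half_sub σ hσ hJ hJu W
  have hWma : ValBound (valuation E ϖ ^ (a - d)) (⅟(2 : E) • (W - J⁻¹ * (W.map σ)ᵀ * J)) := (valBound_half_sub_formAdjoint σ hσv hJb hJib hWa).mono h3a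
  have hxWm : ((x⁻¹ : GL (Fin N) E) : Matrix (Fin N) (Fin N) E) * (⅟(2 : E) • (W - J⁻¹ * (W.map σ)ᵀ * J)) * (x : Matrix (Fin N) (Fin N) E) =
      ⅟(2 : E) • ((((x⁻¹ : GL (Fin N) E) : Matrix (Fin N) (Fin N) E) * W * (x : Matrix (Fin N) (Fin N) E)) -
        J⁻¹ * (((((x⁻¹ : GL (Fin N) E) : Matrix (Fin N) (Fin N) E) * W * (x : Matrix (Fin N) (Fin N) E))).map σ)ᵀ * J) := by
    rw [Matrix.mul_smul, Matrix.smul_mul, Matrix.mul_sub, Matrix.sub_mul, formAdjoint_inv_conj_of_mem σ hJu hx]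
  have hWmb : ValBound (valuation E ϖ ^ (b - d))
      (((x⁻¹ : GL (Fin N) E) : Matrix (Fin N) (Fin N) E) * (⅟(2 : E) • (W - J⁻¹ * (W.map σ)ᵀ * J)) * (x : Matrix (Fin N) (Fin N) E)) := by
    rw [hxWm]; exact (valBound_half_sub_formAdjoint σ hσv hJb hJib hWb).mono h3b
  have key := map_trace_mul_eq_one_of_minus_bilevel σ ψ hϖ hψ hanti hσ hσv hJ hJu hJb hJib hd hXu hXb hx htriv L₀ (a - d) (b - d)
    (max_le_iff.2 ⟨by omega, by omega⟩) (max_le_iff.2 ⟨by omega, by omega⟩) (by omega) _ hWm hWma hWmb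
  rw [hsplit, Matrix.mul_add, Matrix.trace_add, AddChar.map_add_eq_mul, key, map_trace_mul_eq_one_of_eigen σ ψ hanti hJu hXu hWp, one_mul]

/-! ## §3 Non-degeneracy on a unitary layer; near-commutation from agreement on a unitary overlap -/

/-- **EXACT NON-DEGENERACY ON THE UNITARY LAYER**: `X ∈ 𝔰_ε` of any height `L₀`, `χ_X ≡ 1` on `U(σ,J) ∩ K_m`, `ψ` of conductor exactly `𝒪` ⇒ **`v(X) ≤ |ϖ|^{−m′}` for every
`m′ ≥ max(m, d+1) + d`** (`= m` when `d = 0`, `m ≥ 1`).  No a-priori size coupling between `X` and `m` (the endgame's `hint` supplies none). [cite: HarishChandra1999, §17 Thm. 17.1]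
[cite: Weyl1939, Ch. II §10] [cite: PlatonovRapinchuk1994, §3.3] -/
theorem valBound_of_forall_unitary_layer (hϖ : IsUniformizingElement ϖ) (hψ : ∀ x : E, valuation E x ≤ 1 → ψ x = 1)
    (hψ' : ∃ x : E, valuation E x ≤ (valuation E ϖ)⁻¹ ∧ ψ x ≠ 1) {ε : E} (hanti : ∀ a : E, σ a = ε * a → ψ a = 1)
    (hσ : ∀ a : E, σ (σ a) = a) (hσv : ∀ a : E, valuation E (σ a) = valuation E a) (hJ : (J.map σ)ᵀ = J) (hJu : IsUnit J.det)
    {κ κ' : ValueGroupWithZero E} (hJb : ValBound κ J) (hJib : ValBound κ' J⁻¹) {d : ℕ}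
    (hd : valuation E (⅟(2 : E)) * (valuation E (⅟(2 : E)) * max 1 (κ' * κ)) * valuation E ϖ ^ d ≤ 1)
    {X : Matrix (Fin N) (Fin N) E} (hXu : J⁻¹ * (X.map σ)ᵀ * J = ε • X) {L₀ : ℕ} (hXb : ValBound (valuation E ϖ ^ L₀)⁻¹ X) {m : ℕ}
    (htriv : ∀ k ∈ unitaryGroupOfForm σ J, k ∈ congruenceGL N (valuation E ϖ ^ m) → ψ (Matrix.trace (X * ((k : Matrix (Fin N) (Fin N) E) - 1))) = 1)
    {m' : ℕ} (hm' : max m (d + 1) + d ≤ m') : ValBound (valuation E ϖ ^ m')⁻¹ X := by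
  have hm'1 : 1 ≤ m' := by have := le_max_right m (d + 1); omega
  refine (K2E3CongruenceLayerCharactersGL.forall_map_trace_eq_one_iff_valBound ψ hϖ hψ hψ' hm'1 X).1 fun k hk => ?_
  have htriv' : ∀ k ∈ unitaryGroupOfForm σ J, k ∈ congruenceGL N (valuation E ϖ ^ m) → (1 : GL (Fin N) E)⁻¹ * k * 1 ∈ congruenceGL N (valuation E ϖ ^ m) →
      ψ (Matrix.trace (X * ((k : Matrix (Fin N) (Fin N) E) - 1))) = 1 := fun k hk hkm _ => htriv k hk hkm
  refine map_trace_mul_eq_one_of_bilevel σ ψ hϖ hψ hanti hσ hσv hJ hJu hJb hJib hd hXu hXb (Subgroup.one_mem _) htriv' hm' hm' hk.2.1 ?_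
  simpa only [inv_one, Units.val_one, Matrix.one_mul, Matrix.mul_one] using hk.2.1

/-- **NEAR-COMMUTATION FROM AGREEMENT ON A UNITARY OVERLAP (brick hint-U)**: `X, X′ ∈ 𝔰_ε` of height `L₀`, `y ∈ U(σ,J)` of height `h` (`v(y), v(y⁻¹) ≤ |ϖ|^{−h}`), and
`χ_X(y⁻¹ay) = χ_{X′}(a)` for all `a ∈ U ∩ K_m` with `y⁻¹ay ∈ K_m` ⇒ **`v(yXy⁻¹ − X′) ≤ |ϖ|^{−m′}` for every `m′ ≥ max(m + 2h, d+1) + d`** — the overlap contains `U ∩ K_{m+2h}`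
(★ `mem_overlap_of_mem_congruenceGL_pow_add`), there `χ_{yXy⁻¹}∕χ_{X′} ≡ 1` (★ exact equivariance), `yXy⁻¹ − X′ ∈ 𝔰_ε`, and `valBound_of_forall_unitary_layer` applies.  This is the
endgame's `hint` with `H := 2h + 2d + 1`. [cite: HarishChandra1999, §17 p. 80, Thm. 17.1] [cite: PlatonovRapinchuk1994, §3.3] -/
theorem valBound_conj_sub_of_agree_on_unitary_overlap {M' : Type*} [CommGroup M'] (ψ' : AddChar E M') (hϖ : IsUniformizingElement ϖ)
    (hψ : ∀ x : E, valuation E x ≤ 1 → ψ' x = 1) (hψ' : ∃ x : E, valuation E x ≤ (valuation E ϖ)⁻¹ ∧ ψ' x ≠ 1) {ε : E}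
    (hanti : ∀ a : E, σ a = ε * a → ψ' a = 1) (hσ : ∀ a : E, σ (σ a) = a) (hσv : ∀ a : E, valuation E (σ a) = valuation E a) (hJ : (J.map σ)ᵀ = J)
    (hJu : IsUnit J.det) {κ κ' : ValueGroupWithZero E} (hJb : ValBound κ J) (hJib : ValBound κ' J⁻¹) {d : ℕ}
    (hd : valuation E (⅟(2 : E)) * (valuation E (⅟(2 : E)) * max 1 (κ' * κ)) * valuation E ϖ ^ d ≤ 1)
    {X X' : Matrix (Fin N) (Fin N) E} (hXu : J⁻¹ * (X.map σ)ᵀ * J = ε • X) (hX'u : J⁻¹ * (X'.map σ)ᵀ * J = ε • X') {L₀ : ℕ}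
    (hXb : ValBound (valuation E ϖ ^ L₀)⁻¹ X) (hX'b : ValBound (valuation E ϖ ^ L₀)⁻¹ X')
    {y : GL (Fin N) E} (hy : y ∈ unitaryGroupOfForm σ J) {h : ℕ} (hyh : ValBound (valuation E ϖ ^ h)⁻¹ (y : Matrix (Fin N) (Fin N) E))
    (hyh' : ValBound (valuation E ϖ ^ h)⁻¹ ((y⁻¹ : GL (Fin N) E) : Matrix (Fin N) (Fin N) E)) {m : ℕ}
    (hagree : ∀ a ∈ unitaryGroupOfForm σ J, a ∈ congruenceGL N (valuation E ϖ ^ m) → y⁻¹ * a * y ∈ congruenceGL N (valuation E ϖ ^ m) →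
      ψ' (Matrix.trace (X * (((y⁻¹ * a * y : GL (Fin N) E) : Matrix (Fin N) (Fin N) E) - 1))) = ψ' (Matrix.trace (X' * ((a : Matrix (Fin N) (Fin N) E) - 1))))
    {m' : ℕ} (hm' : max (m + 2 * h) (d + 1) + d ≤ m') :
    ValBound (valuation E ϖ ^ m')⁻¹ ((y : Matrix (Fin N) (Fin N) E) * X * ((y⁻¹ : GL (Fin N) E) : Matrix (Fin N) (Fin N) E) - X') := by
  have hπ0 : 0 < valuation E ϖ := (Valuation.pos_iff _).2 hϖ.ne_zero
  -- `D := yXy⁻¹ − X′ ∈ 𝔰_ε`, of height `L₀ + 2h`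
  have hDu : J⁻¹ * (((y : Matrix (Fin N) (Fin N) E) * X * ((y⁻¹ : GL (Fin N) E) : Matrix (Fin N) (Fin N) E) - X').map σ)ᵀ * J =
      ε • ((y : Matrix (Fin N) (Fin N) E) * X * ((y⁻¹ : GL (Fin N) E) : Matrix (Fin N) (Fin N) E) - X') := by
    rw [formAdjoint_sub σ, formAdjoint_conj_eq_smul_of_mem σ hJu hy hXu, hX'u, smul_sub]
  have hDb : ValBound (valuation E ϖ ^ (L₀ + 2 * h))⁻¹ ((y : Matrix (Fin N) (Fin N) E) * X * ((y⁻¹ : GL (Fin N) E) : Matrix (Fin N) (Fin N) E) - X') := by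
    refine ValBound.sub (((hyh.mul hXb).mul hyh').mono (le_of_eq ?_)) (hX'b.mono (inv_anti₀ (pow_pos hπ0 _) (pow_le_pow_right_of_le_one' hϖ.valuation_le_one (by omega))))
    rw [← mul_inv, ← mul_inv, ← pow_add, ← pow_add, show h + L₀ + h = L₀ + 2 * h by ring]
  -- `χ_D ≡ 1` on `U ∩ K_{m+2h}`
  have htriv : ∀ k ∈ unitaryGroupOfForm σ J, k ∈ congruenceGL N (valuation E ϖ ^ (m + 2 * h)) →
      ψ' (Matrix.trace (((y : Matrix (Fin N) (Fin N) E) * X * ((y⁻¹ : GL (Fin N) E) : Matrix (Fin N) (Fin N) E) - X') * ((k : Matrix (Fin N) (Fin N) E) - 1))) = 1 := by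
    intro k hk hkm
    obtain ⟨hk0, -, hk2⟩ := K2E3CongruenceLayerIntertwiningGL.mem_overlap_of_mem_congruenceGL_pow_add hϖ m h hyh hyh' hkm
    have e := hagree k hk hk0 hk2
    rw [show y⁻¹ * k * y = y⁻¹ * k * y⁻¹⁻¹ by rw [inv_inv], K2E3CongruenceLayerCharactersGL.map_trace_mul_coe_conj_sub_one, inv_inv] at e
    rw [Matrix.sub_mul, Matrix.trace_sub, AddChar.map_sub_eq_div, e, div_self']
  exact valBound_of_forall_unitary_layer σ ψ' hϖ hψ hψ' hanti hσ hσv hJ hJu hJb hJib hd hDu hDb htriv hm'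

end Induction

end Summit.HodgeConjecture.HodgeConjecture.Cruxes.H413.K2E3UnitaryLayerCharacters

end
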